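import Summits.AnomalousDissipation.AnomalousDissipation.Theorems.SolenoidalFractalHomogenisationLagrangianStepVmodSfHigh
import HarnessLib

/-!
# K1L_D (stmt-AnomalousDissipation-27980): (V_mod) flat stage, block (ff) — THE HIGH-LABEL ROWS for class data (W7 at any phase)
# (prover ad-k3l-bookkeeping-p1 g10; RULING D28-9 / D28-17 (a) assign the (ff) grid twin to the k3l lineage; helper `--supports 27980 --as helper`)

The (ff) twin of `…VmodSfHigh.sfMode_high` (p719411).  W7 decays EVERY datum supported in the class pair `±ℓ + nℤ³` of a HIGH label
(`VmodGen.norm_apply_le_of_highLabelDecay_anyPhase`, p718623 — the clause `HighLabelDecayW` excludes whole Bloch classes, not only the pair `{±ℓ}`),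
so the (ff) per-label bound on high labels needs neither (V) nor the divergence-free / vanishing-at-`±ℓ` structure of the datum, and it comes in the
plain `‖w‖·‖ζ‖` currency of the (ff) text `FFModeP_textEVH` (`…VmodFfTextsP`, p728086):
* `ν < νh`: `‖U s t w‖ ≤ √CK·e^{cK·M·Wp}·e^{−cK·ν·(t−s)}‖w‖ ≤ (√CK·e^{a}/√a)·x^{eσ}‖w‖`, `a = cK·M·Wp`, `x = P/(t−s) ∈ (0,1]`
  (`exp_neg_div_le_rpow_div_sqrt`; uses `e σ ≤ 1/2`);
* `νh ≤ ν (< ν₀ ≤ 1)`: the FLOOR pays — `1 ≤ C₂²·ν^{eσ}` since `ν^{eσ} ≥ √ν ≥ √νh` and `C₂ ≥ 1/√νh`, `C₂ ≥ 1`.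
Main statement **`ffMode_high`** with `C₂ := √CK·exp(cK·M·Wp)/√(cK·M·Wp) + 1/√νh + 1` (free of `n, ν, ℓ, s, t`), W7 instantiated ONCE at
`Kb := (K+1)/g₀`.  `sorry`-free; NOT a proof of (ff), of the stub, of K1L_D or of AD; rung F-D1.A0.
-/

set_option linter.dupNamespace false

noncomputable section

namespace Summit.AnomalousDissipation.AnomalousDissipation.Theorems.SolenoidalFractalHomogenisation.LagrangianStep.VmodFlat

open Set MeasureTheory Complex UnitAddTorus Filter Topology
open scoped InnerProductSpace ENNReal
open Literature.Analysis Literature.Analysis.FunctionSpaces Literature.Analysis.FunctionSpaces.Torus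
open Literature.Analysis.FluidPDE Literature.Analysis.FluidPDE.Torus Literature.Analysis.FluidPDE.LatticeShear
open Summit.AnomalousDissipation.AnomalousDissipation.Theorems.SolenoidalFractalHomogenisation.LagrangianStep.CellClauseMod
open Summit.AnomalousDissipation.AnomalousDissipation.Theorems.SolenoidalFractalHomogenisation.LagrangianStep.VmodGen
  (norm_apply_le_of_highLabelDecay_anyPhase)

set_option maxHeartbeats 3200000 in
/-- **THE HIGH-LABEL ROWS OF `FFModeP_textEVH e`** (general phase; W7 at `Kb = (K+1)/g₀`; floor for `ν ≥ νh`).  For every `g₀ ∈ (0,1]` and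
every exponent map with `0 < e σ ≤ 1/2`: the W7 family gives `C₂ ≥ 0` (free of `n, ν, ℓ, s, t`) such that for every cell member `U`, every LONG
window `M·W.period/ν < t − s`, every nonzero slow label with `g₀·n ≤ ‖ℓ‖·⌈K/ν⌉`, every CLASS datum `w` of `ℓ` (`𝓕w ⊆ ±ℓ + nℤ³`) and EVERY
test `ζ`:  `|⟪U s t w, ζ⟫| ≤ C₂(C₂(ν^{eσ} + (⌈K/ν⌉/n)^{eσ}) + (min 1 (P/(t−s)))^{eσ})·‖w‖·‖ζ‖`. -/
theorem ffMode_high (e : ℝ → ℝ) (he : ∀ σ, 0 < σ → 0 < e σ ∧ e σ ≤ 1 / 2) {g₀ : ℝ} (hg₀ : 0 < g₀) (hg₀1 : g₀ ≤ 1)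
    {k : ℕ} (W : LatticeShear.LatticeWord k) (M : ℝ) (hM : 0 < M) {lo hi Λ β σ ν₀ K : ℝ}
    (hlo : 0 < lo) (hhi : 1 ≤ hi) (hΛ : 1 < Λ) (hσ : 0 < σ) (hν₀1 : ν₀ ≤ 1) (hK : 0 < K)
    (hH : ∀ Kb : ℝ, 1 ≤ Kb → ∃ CK : ℝ, 1 ≤ CK ∧ ∃ cK > (0:ℝ), ∃ νh > (0:ℝ), HighLabelDecayW W M hM lo hi Λ β νh Kb CK cK) :
    ∃ C₂ : ℝ, 0 ≤ C₂ ∧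
    ∀ ν, ∀ hν : ν ∈ Set.Ioo 0 ν₀, ∀ n : ℕ, (⌈K / ν⌉₊ : ℝ) ≤ n → ∀ 𝔸 : Torus.Visc4 (Fin 3),
      Torus.OddSmall 𝔸 (ν * β) → (∃ lam ∈ Set.Icc (1:ℝ) Λ, Torus.NearIso 𝔸 (ν * (lo / lam)) (ν * (hi * lam))) →
      ∀ Tw > (0:ℝ), ∀ U : ℝ → ℝ → (V2 →L[ℝ] V2),
        Torus.IsPropagator Tw (cellField W M hM ν hν.1 n) ((1 / (n:ℝ) ^ 2) • 𝔸) U →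
      ∀ s t : ℝ, 0 ≤ s → s < t → t ≤ Tw → M * W.period / ν < t - s →
      ∀ ℓ ∈ (Torus.freqBall (d := Fin 3) (n / 4)).erase 0, g₀ * n ≤ ‖Torus.latticeVec ℓ‖ * (⌈K / ν⌉₊ : ℝ) →
      ∀ w : V2, (∀ k', fc w k' ≠ 0 → (∀ i, (n : ℤ) ∣ k' i - ℓ i) ∨ (∀ i, (n : ℤ) ∣ k' i + ℓ i)) → ∀ ζ : V2,
        |⟪U s t w, ζ⟫_ℝ|
          ≤ (C₂ * (C₂ * (ν ^ e σ + ((⌈K / ν⌉₊ : ℝ) / n) ^ e σ) + (min 1 ((M * W.period / ν) / (t - s))) ^ e σ)) * ‖w‖ * ‖ζ‖ := by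
  classical
  obtain ⟨-, he1⟩ := he σ hσ
  have hΛ1 : 1 ≤ Λ := hΛ.le
  have hWp : 0 < W.period :=
    Summit.AnomalousDissipation.AnomalousDissipation.Theorems.SolenoidalFractalHomogenisation.PermissibleCarrier.period_pos W
  -- ### the W7 instance at `Kb = (K+1)/g₀`
  have hKb : (1:ℝ) ≤ (K + 1) / g₀ := by rw [le_div_iff₀ hg₀]; linarith
  obtain ⟨CK, hCK1, cK, hcK, νh, hνh, hW7⟩ := hH ((K + 1) / g₀) hKb
  have hCK0 : 0 ≤ CK := by linarith
  -- ### the constants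
  set a : ℝ := cK * (M * W.period) with ha
  have ha0 : 0 < a := by rw [ha]; positivity
  set C₂ : ℝ := Real.sqrt CK * Real.exp a / Real.sqrt a + 1 / Real.sqrt νh + 1 with hC₂
  have hC₂a : Real.sqrt CK * Real.exp a / Real.sqrt a ≤ C₂ := by
    rw [hC₂]; have : 0 ≤ 1 / Real.sqrt νh := by positivity
    linarith
  have hC₂b : 1 / Real.sqrt νh ≤ C₂ := by
    rw [hC₂]; have : 0 ≤ Real.sqrt CK * Real.exp a / Real.sqrt a := by positivity
    linarith
  have hC₂1 : 1 ≤ C₂ := by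
    rw [hC₂]; have : 0 ≤ Real.sqrt CK * Real.exp a / Real.sqrt a := by positivity
    have : 0 ≤ 1 / Real.sqrt νh := by positivity
    linarith
  have hC₂0 : 0 ≤ C₂ := by linarith
  refine ⟨C₂, hC₂0, ?_⟩
  intro ν hν n hn 𝔸 hodd hwin Tw hTw U hU s t hs hst htT hlong ℓ hℓ hhigh w hwcp ζ
  -- ### bookkeeping
  have hν1 : ν ≤ 1 := by linarith [hν.2]
  have hn1 : (1:ℝ) ≤ n := by
    have h1 : (1:ℝ) ≤ ⌈K / ν⌉₊ := by
      have : 0 < K / ν := div_pos hK hν.1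
      exact_mod_cast Nat.one_le_iff_ne_zero.2 (Nat.pos_iff_ne_zero.1 (Nat.ceil_pos.2 this))
    exact h1.trans hn
  have hnpos : 0 < n := by exact_mod_cast (show (0:ℝ) < n by linarith)
  have hn1' : 1 ≤ n := hnpos
  have hn0 : (0:ℝ) < n := by exact_mod_cast hnpos
  have hτ : 0 < t - s := sub_pos.2 hst
  have hν0 : 0 < ν := hν.1
  set P : ℝ := M * W.period / ν with hP
  have hP0 : 0 < P := by rw [hP]; positivity
  have hνP : ν * P = M * W.period := by rw [hP]; field_simp
  -- the label
  have hℓ0 : ℓ ≠ 0 := Finset.ne_of_mem_erase hℓ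
  have hℓball := Finset.mem_of_mem_erase hℓ
  have hLpos : 0 < ‖Torus.latticeVec ℓ‖ := by
    rcases (norm_nonneg (Torus.latticeVec ℓ)).eq_or_lt with h0 | h0
    · exfalso; apply hℓ0
      have hz : FunctionSpaces.Torus.freqNormSq ℓ = 0 := by rw [← norm_latticeVec_sq', ← h0]; ring
      unfold FunctionSpaces.Torus.freqNormSq at hz
      have hall := (Finset.sum_eq_zero_iff_of_nonneg fun i _ => sq_nonneg ((ℓ i : ℝ))).1 hz
      funext i
      have := hall i (Finset.mem_univ i)
      exact_mod_cast pow_eq_zero_iff two_ne_zero |>.1 this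
    · exact h0
  have hℓn : 2 * ‖Torus.latticeVec ℓ‖ ≤ n := by
    have h1 : FunctionSpaces.Torus.freqNormSq ℓ ≤ (((n / 4 : ℕ) : ℝ)) ^ 2 := FunctionSpaces.Torus.mem_freqBall.1 hℓball
    have h2 : (((n / 4 : ℕ) : ℝ)) ≤ (n:ℝ) / 4 := by
      have : ((n / 4 : ℕ) : ℝ) * 4 ≤ n := by exact_mod_cast Nat.div_mul_le_self n 4
      linarith
    have h3 : ‖Torus.latticeVec ℓ‖ ^ 2 ≤ ((n:ℝ) / 4) ^ 2 := by
      rw [norm_latticeVec_sq']; exact h1.trans (pow_le_pow_left₀ (Nat.cast_nonneg _) h2 2)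
    have h4 : ‖Torus.latticeVec ℓ‖ ≤ (n:ℝ) / 4 := by
      nlinarith [norm_nonneg (Torus.latticeVec ℓ), sq_nonneg (‖Torus.latticeVec ℓ‖ - (n:ℝ) / 4)]
    linarith
  have hKL : (n : ℝ) * ν ≤ (K + 1) / g₀ * ‖Torus.latticeVec ℓ‖ := by
    have h1 := ceil_mul_le hK.le hν.1 hν1
    have h2 : g₀ * n * ν ≤ ‖Torus.latticeVec ℓ‖ * ((⌈K / ν⌉₊ : ℝ) * ν) := by
      have := mul_le_mul_of_nonneg_right hhigh hν.1.le
      linarith [this]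
    have h3 : ‖Torus.latticeVec ℓ‖ * ((⌈K / ν⌉₊ : ℝ) * ν) ≤ ‖Torus.latticeVec ℓ‖ * (K + 1) := mul_le_mul_of_nonneg_left h1 (norm_nonneg _)
    rw [div_mul_eq_mul_div, le_div_iff₀ hg₀]
    nlinarith
  -- ### the allowance pieces
  set X : ℝ := ν ^ e σ + ((⌈K / ν⌉₊ : ℝ) / n) ^ e σ with hX
  have hX0 : 0 ≤ X := by
    have h1 : 0 ≤ ν ^ e σ := Real.rpow_nonneg hν.1.le _
    have h2 : 0 ≤ ((⌈K / ν⌉₊ : ℝ) / n) ^ e σ := Real.rpow_nonneg (by positivity) _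
    rw [hX]; linarith
  set x : ℝ := P / (t - s) with hx
  have hx0 : 0 < x := by rw [hx]; positivity
  have hx1 : x ≤ 1 := by rw [hx, div_le_one hτ]; exact hlong.le
  have hmin : min 1 (P / (t - s)) = x := by rw [hx]; exact min_eq_right hx1
  set η : ℝ := C₂ * (C₂ * X + x ^ e σ) with hη
  have hxe0 : 0 ≤ x ^ e σ := Real.rpow_nonneg hx0.le _
  have hη_floor : C₂ * (C₂ * ν ^ e σ) ≤ η := by
    rw [hη, hX]
    have h2 : 0 ≤ ((⌈K / ν⌉₊ : ℝ) / n) ^ e σ := Real.rpow_nonneg (by positivity) _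
    nlinarith [mul_nonneg hC₂0 (mul_nonneg hC₂0 h2), mul_nonneg hC₂0 hxe0]
  have hη_cap : C₂ * x ^ e σ ≤ η := by
    rw [hη]; nlinarith [mul_nonneg hC₂0 (mul_nonneg hC₂0 hX0)]
  -- ### the two regimes in ν
  have hwζ : 0 ≤ ‖w‖ * ‖ζ‖ := by positivity
  have key : |⟪U s t w, ζ⟫_ℝ| ≤ η * ‖w‖ * ‖ζ‖ := by
    by_cases hνh' : ν < νh
    · -- W7 at general phase, class datum
      have hν' : ν ∈ Set.Ioo 0 νh := ⟨hν.1, hνh'⟩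
      have hdec := norm_apply_le_of_highLabelDecay_anyPhase W M hM hW7 hlo (by linarith) hΛ1 hCK0 hcK.le hν' hn1' hodd hwin
        (U := U) hU hs hlong.le htT hLpos hKL hℓ0 le_rfl hℓn w hwcp
      have hkill : Real.sqrt CK * Real.exp a * Real.exp (-(cK * ν * (t - s))) ≤ C₂ * x ^ e σ := by
        have e1 : cK * ν * (t - s) = a / x := by
          rw [ha, hx, ← hνP]; field_simp
        rw [e1]
        have h1 := exp_neg_div_le_rpow_div_sqrt ha0 hx0 hx1 he1
        have h2 : Real.sqrt CK * Real.exp a * Real.exp (-(a / x)) ≤ Real.sqrt CK * Real.exp a * (x ^ e σ / Real.sqrt a) :=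
          mul_le_mul_of_nonneg_left h1 (by positivity)
        have h3 : Real.sqrt CK * Real.exp a * (x ^ e σ / Real.sqrt a) = (Real.sqrt CK * Real.exp a / Real.sqrt a) * x ^ e σ := by
          field_simp
        rw [h3] at h2
        exact h2.trans (mul_le_mul_of_nonneg_right hC₂a hxe0)
      calc |⟪U s t w, ζ⟫_ℝ| ≤ ‖U s t w‖ * ‖ζ‖ := abs_real_inner_le_norm _ _
        _ ≤ (Real.sqrt CK * Real.exp (cK * (M * W.period)) * Real.exp (-(cK * ν * (t - s))) * ‖w‖) * ‖ζ‖ :=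
            mul_le_mul_of_nonneg_right hdec (norm_nonneg _)
        _ = (Real.sqrt CK * Real.exp a * Real.exp (-(cK * ν * (t - s)))) * (‖w‖ * ‖ζ‖) := by rw [ha]; ring
        _ ≤ (C₂ * x ^ e σ) * (‖w‖ * ‖ζ‖) := mul_le_mul_of_nonneg_right hkill hwζ
        _ ≤ η * (‖w‖ * ‖ζ‖) := mul_le_mul_of_nonneg_right hη_cap hwζ
        _ = η * ‖w‖ * ‖ζ‖ := by ring
    · -- the floor pays: `1 ≤ C₂² ν^{e}`
      rw [not_lt] at hνh'
      have hνe : Real.sqrt νh ≤ ν ^ e σ := by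
        calc Real.sqrt νh ≤ Real.sqrt ν := Real.sqrt_le_sqrt hνh'
          _ = ν ^ (1 / 2 : ℝ) := Real.sqrt_eq_rpow ν
          _ ≤ ν ^ e σ := Real.rpow_le_rpow_of_exponent_ge hν.1 hν1 he1
      have hfloor : 1 ≤ C₂ * (C₂ * ν ^ e σ) := by
        have hsνh : 0 < Real.sqrt νh := Real.sqrt_pos.2 hνh
        have h1 : 1 ≤ C₂ * ν ^ e σ := by
          have h2 : 1 / Real.sqrt νh * Real.sqrt νh ≤ C₂ * ν ^ e σ := mul_le_mul hC₂b hνe hsνh.le hC₂0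
          rwa [one_div, inv_mul_cancel₀ hsνh.ne'] at h2
        have h0 : 0 ≤ C₂ * ν ^ e σ := mul_nonneg hC₂0 (Real.rpow_nonneg hν.1.le _)
        nlinarith
      calc |⟪U s t w, ζ⟫_ℝ| ≤ ‖U s t w‖ * ‖ζ‖ := abs_real_inner_le_norm _ _
        _ ≤ ‖w‖ * ‖ζ‖ := mul_le_mul_of_nonneg_right (hU.norm_le s t w) (norm_nonneg _)
        _ ≤ (C₂ * (C₂ * ν ^ e σ)) * (‖w‖ * ‖ζ‖) := le_mul_of_one_le_left hwζ hfloor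
        _ ≤ η * (‖w‖ * ‖ζ‖) := mul_le_mul_of_nonneg_right hη_floor hwζ
        _ = η * ‖w‖ * ‖ζ‖ := by ring
  rw [hmin]
  calc |⟪U s t w, ζ⟫_ℝ| ≤ η * ‖w‖ * ‖ζ‖ := key
    _ = _ := by rw [hη, hX]

end Summit.AnomalousDissipation.AnomalousDissipation.Theorems.SolenoidalFractalHomogenisation.LagrangianStep.VmodFlat

end
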